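import Summits.QuantumFields.YangMills.Theorems.SlowBitWindowInsertionTraceSpectral
import HarnessLib

/-!
# The eigen-data of the zero-flux transfer operator: a Hilbert basis of `L²` through the complete physical eigenbasis, with
# Bessel and bilinear spectral expansions against honest bounded test functions

Support module for the door `SwapTwistDeficit.CauchySchwarzDoor` (stmt-QuantumFields-23319, aside of route `SwapTwistDeficit`,
D-0145 LINE g10-B of seat ym-idea-4; the bridge by which `SlowBitWindow`'s cruxes imply `TwistDeficit`).  The existential spectral
representations `insTrace_spectral` ∕ `twistTrace_spectral` each choose their own eigen-sequence; the parity argument of the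
Cauchy–Schwarz door needs ONE eigen-sequence for the two-insertion trace, the swap-twisted trace AND auxiliary bilinear expansions.  This
module therefore exposes the construction once, as data with hypotheses that downstream theorems take as arguments:

* §1 **`exists_eigenData`** — for `β > 0` there are a countable index type `ι`, a Hilbert basis `b` of `L²(configMeasure)`, eigenvalues
  `lam ≥ 0` of the `L²` operator `A_P` of the physically averaged kernel `K_β^P` (`A_P bᵢ = lamᵢ bᵢ`, self-adjoint), an injection
  `emb : ℕ → ι` off whose range `lam = 0` and on whose range `lam (emb k) = levelValue su2Rep L β k` and `b (emb k)` is the class of the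
  honest physical eigenfunction `e_k` (`K_β e_k = λ_k e_k`, `l2`-orthonormal, `e_0` invariant under axis permutations) — the construction of
  `TT.traceFormula` ∕ `insTrace_spectral`, packaged;
* §2 `eigenData_bessel` — `Σ_k (∫ f e_k)² ≤ ∫ f²` for bounded measurable `f`;
* §3 `eigenData_bilinear` — `Σ_k λ_k^n (∫ f e_k)(∫ g e_k) = ∫ f · (κ_P^[n] g)` for bounded measurable `f, g` and `n ≥ 1`.

HONEST FRAMING: fixed-lattice spectral bookkeeping (Reed–Simon I Thm. VI.22–23) for an M-sized aside item of a DRAFT line onto a RECORD rung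
(K2a); no renormalisation-group content; nothing here bears on infinite volume, the continuum limit, a mass gap or Clay.
References: [cite: ReedSimonI1980, Thm. VI.22–VI.23]; [cite: ReedSimonIV1978, Thm. XIII.1]; [cite: MontvayMunster1994, (3.145)].
-/

set_option autoImplicit false

noncomputable section

open MeasureTheory Filter Topology Function
open Literature.MathematicalPhysics.QuantumFieldTheory
open Literature.MathematicalPhysics.QuantumLattice
open Literature.Analysis.OperatorTheory.YMMatrixModel
open Literature.Analysis.OperatorTheory
open scoped InnerProductSpace BigOperators

namespace Summit.QuantumFields.YangMills.Theorems.FemtoTransferGap.TT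

open Summit.QuantumFields.YangMills.Theorems.FemtoTransferGap
open Summit.QuantumFields.YangMills.Theorems.FemtoTransferGap.PhysL2

variable {L : ℕ} [NeZero L]

/-! ## §1 The eigen-data -/

set_option maxHeartbeats 1600000 in
/-- **Eigen-data of the zero-flux transfer operator.**  For `β > 0`: a countable Hilbert basis `b` of `L²(configMeasure)` of eigenvectors of
the `L²` operator `A_P` of `K_β^P` (eigenvalues `lam ≥ 0`), through which the complete physical eigenbasis `e_k` (honest physical zero-flux
test functions, `K_β e_k = λ_k e_k`, `λ_k = levelValue su2Rep L β k`, `l2`-orthonormal, `e_0` a raw vacuum invariant under axis permutations)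
is embedded by `emb : ℕ → ι`, with `lam = 0` off the range of `emb`. [cite: ReedSimonI1980, Thm. VI.22–VI.23] [cite: ReedSimonIV1978, Thm. XIII.1] -/
theorem exists_eigenData {β : ℝ} (hβ : 0 < β) :
    ∃ (ι : Type) (_ : Countable ι) (b : HilbertBasis ι ℝ (Lp ℝ 2 (configMeasure SU2 L))) (lam : ι → ℝ)
      (AP : Lp ℝ 2 (configMeasure SU2 L) →L[ℝ] Lp ℝ 2 (configMeasure SU2 L)) (emb : ℕ → ι)
      (e : ℕ → (GaugeConfig 3 L SU2 → ℝ)),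
      (∀ φ : Lp ℝ 2 (configMeasure SU2 L),
        (AP φ : GaugeConfig 3 L SU2 → ℝ) =ᵐ[configMeasure SU2 L] fun x => ∫ y, physKernel β x y * φ y ∂configMeasure SU2 L) ∧
      IsSelfAdjoint AP ∧
      (∀ i, AP (b i) = lam i • b i) ∧ (∀ i, 0 ≤ lam i) ∧
      Function.Injective emb ∧ (∀ i ∉ Set.range emb, lam i = 0) ∧
      (∀ k, lam (emb k) = levelValue su2Rep L β k) ∧
      (∀ k, ((b (emb k) : Lp ℝ 2 (configMeasure SU2 L)) : GaugeConfig 3 L SU2 → ℝ) =ᵐ[configMeasure SU2 L] e k) ∧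
      (∀ k, IsPhys (e k)) ∧
      (∀ k l, l2 (e k) (e l) = if k = l then 1 else 0) ∧
      (∀ k, transferApply β (e k) = levelValue su2Rep L β k • e k) ∧
      (∀ (σ : Equiv.Perm (Fin 3)) (U : GaugeConfig 3 L SU2), e 0 (configPerm σ U) = e 0 U) := by
  classical
  haveI : SecondCountableTopology SU2 := secondCountableTopology_su2
  haveI : Fact ((2 : ENNReal) ≠ ⊤) := ⟨ENNReal.ofNat_ne_top⟩
  haveI : CompleteSpace (physL2 L) := isClosed_physL2.completeSpace_coe
  obtain ⟨M0, -, hM0⟩ := exists_abs_transferKernel_le (L := L) β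
  -- the two `L²` operators
  obtain ⟨A, hA, hsa, -⟩ := exists_transferOpL2 (L := L) β
  have hKP := stronglyMeasurable_physKernel (L := L) β
  have hCP : ∀ U V : GaugeConfig 3 L SU2, ‖physKernel β U V‖ ≤ M0 := fun U V => by
    rw [Real.norm_eq_abs]; exact abs_physKernel_le hM0 U V
  obtain ⟨AP, hAP⟩ := exists_kernelOp (μ := configMeasure SU2 L) hKP hCP
  have hsaP : IsSelfAdjoint AP := isSelfAdjoint_kernelOp hKP hCP (physKernel_symm β) hAP
  -- the honest physical eigen-sequence
  obtain ⟨e, hon, heig, -, hker⟩ := exists_isPhys_eigenseq (L := L) hβ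
  set u : ℕ → Lp ℝ 2 (configMeasure SU2 L) := fun n => toL2 (e n) with hu
  have hu_on : Orthonormal ℝ u := by
    rw [orthonormal_iff_ite]
    intro i l
    rw [hu, inner_toL2]
    exact hon i l
  have hAe : ∀ k, A (u k) = levelValue su2Rep L β k • u k := fun k => by
    have h1 : transferOp β (e k) = levelValue su2Rep L β k • e k := Subtype.ext (by rw [coe_transferOp, heig k]; rfl)
    simp only [hu]
    rw [apply_toL2 hA, h1, map_smul]
  have hkerA : ∀ x : Lp ℝ 2 (configMeasure SU2 L), x ∈ physL2 L → (∀ i, ⟪u i, x⟫_ℝ = 0) → A x = 0 := by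
    intro x hx hx'
    have h0 := hker x hx hx'
    apply Lp.ext
    filter_upwards [hA x, Lp.coeFn_zero ℝ 2 (configMeasure SU2 L)] with U h1 h2
    rw [h1, h2, Pi.zero_apply, h0 U]
  -- the Hilbert basis «`u` ⊕ a Hilbert basis of the orthogonal complement of its closed span»
  set E : Submodule ℝ (Lp ℝ 2 (configMeasure SU2 L)) := (Submodule.span ℝ (Set.range u)).topologicalClosure with hE
  have hu_mem : ∀ n, u n ∈ E := fun n => Submodule.le_topologicalClosure _ (Submodule.subset_span (Set.mem_range_self n))
  have hu_phys : ∀ n, u n ∈ physL2 L := fun n => toL2_mem_physL2 (e n)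
  obtain ⟨w, c, hwc⟩ := exists_hilbertBasis ℝ (↥Eᗮ)
  have hc_on' : Orthonormal ℝ ((↑) : w → ↥Eᗮ) := hwc ▸ c.orthonormal
  haveI : Countable w := (hc_on'.countable_of_separableSpace (𝕜 := ℝ)).to_subtype
  have hc_on : Orthonormal ℝ (fun j : w => (((j : ↥Eᗮ)) : Lp ℝ 2 (configMeasure SU2 L))) :=
    Eᗮ.subtypeₗᵢ.orthonormal_comp_iff.mpr hc_on'
  set v : ℕ ⊕ w → Lp ℝ 2 (configMeasure SU2 L) := Sum.elim u (fun j : w => ((j : ↥Eᗮ) : Lp ℝ 2 (configMeasure SU2 L))) with hvdef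
  have hv : Orthonormal ℝ v := by
    rw [orthonormal_iff_ite]
    rintro (n | j) (n' | j')
    · simp only [hvdef, Sum.elim_inl, Sum.inl.injEq]
      exact (orthonormal_iff_ite.mp hu_on) n n'
    · simp only [hvdef, Sum.elim_inl, Sum.elim_inr, reduceCtorEq, if_false]
      exact Submodule.inner_right_of_mem_orthogonal (hu_mem n) (j' : ↥Eᗮ).2
    · simp only [hvdef, Sum.elim_inl, Sum.elim_inr, reduceCtorEq, if_false]
      exact Submodule.inner_left_of_mem_orthogonal (hu_mem n') (j : ↥Eᗮ).2
    · simp only [hvdef, Sum.elim_inr, Sum.inr.injEq]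
      exact (orthonormal_iff_ite.mp hc_on) j j'
  have hrange : Set.range u ⊆ Set.range v := by
    rintro _ ⟨n, rfl⟩; exact ⟨Sum.inl n, rfl⟩
  have hspan : (Submodule.span ℝ (Set.range v))ᗮ = ⊥ := by
    rw [Submodule.eq_bot_iff]
    intro y hy
    have hyv : ∀ i, ⟪v i, y⟫_ℝ = 0 := fun i =>
      Submodule.inner_right_of_mem_orthogonal (Submodule.subset_span (Set.mem_range_self i)) hy
    have hyE : y ∈ Eᗮ := by
      rw [Submodule.mem_orthogonal]
      intro z hz
      have hS : IsClosed {z : Lp ℝ 2 (configMeasure SU2 L) | ⟪z, y⟫_ℝ = 0} :=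
        isClosed_eq (continuous_id.inner continuous_const) continuous_const
      have hsub : ((Submodule.span ℝ (Set.range u) : Submodule ℝ (Lp ℝ 2 (configMeasure SU2 L))) :
          Set (Lp ℝ 2 (configMeasure SU2 L))) ⊆ {z | ⟪z, y⟫_ℝ = 0} := fun z hz =>
        Submodule.inner_right_of_mem_orthogonal (Submodule.span_mono hrange hz) hy
      have hz' : z ∈ closure ((Submodule.span ℝ (Set.range u) : Submodule ℝ (Lp ℝ 2 (configMeasure SU2 L))) :
          Set (Lp ℝ 2 (configMeasure SU2 L))) := by
        rw [← Submodule.topologicalClosure_coe]; exact hz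
      exact closure_minimal hsub hS hz'
    set y' : ↥Eᗮ := ⟨y, hyE⟩ with hy'
    have hc0 : ∀ j : w, ⟪c j, y'⟫_ℝ = 0 := fun j => by
      rw [show c j = (j : ↥Eᗮ) from congrFun hwc j, Submodule.coe_inner]
      exact hyv (Sum.inr j)
    have hrepr : c.repr y' = 0 := by
      ext j
      rw [c.repr_apply_apply, hc0 j]
      rfl
    have hy'0 : y' = 0 := by simpa using congrArg c.repr.symm hrepr
    exact congrArg Subtype.val hy'0
  set b : HilbertBasis (ℕ ⊕ w) ℝ (Lp ℝ 2 (configMeasure SU2 L)) := HilbertBasis.mkOfOrthogonalEqBot hv hspan with hbdef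
  have hb : ∀ i, b i = v i := fun i => by rw [hbdef, HilbertBasis.coe_mkOfOrthogonalEqBot]
  -- eigen-relations of the operator of `K_β^P` along `b`
  set lam : ℕ ⊕ w → ℝ := Sum.elim (fun k => levelValue su2Rep L β k) (fun _ => 0) with hlamdef
  have hbAP : ∀ i, AP (b i) = lam i • b i := by
    intro i
    rw [hb]
    rcases i with n | j
    · simp only [hvdef, hlamdef, Sum.elim_inl]
      rw [kernelOpP_apply_of_mem_physL2 hM0 hA hAP (hu_phys n), hAe]
    · simp only [hvdef, hlamdef, Sum.elim_inr, zero_smul]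
      set y : Lp ℝ 2 (configMeasure SU2 L) := ((j : ↥Eᗮ) : Lp ℝ 2 (configMeasure SU2 L)) with hydef
      have hyE : y ∈ Eᗮ := (j : ↥Eᗮ).2
      set y₁ : Lp ℝ 2 (configMeasure SU2 L) := (physL2 L).starProjection y with hy₁def
      have hy₁ : y₁ ∈ physL2 L := Submodule.starProjection_apply_mem _ y
      have hy₂ : y - y₁ ∈ (physL2 L)ᗮ := Submodule.sub_starProjection_mem_orthogonal y
      have h1 : AP (y - y₁) = 0 := kernelOpP_apply_of_mem_orthogonal hM0 hAP hy₂
      have h2 : AP y₁ = A y₁ := kernelOpP_apply_of_mem_physL2 hM0 hA hAP hy₁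
      have h3 : A y₁ = 0 := by
        refine hkerA y₁ hy₁ fun i => ?_
        have ha : ⟪u i, y⟫_ℝ = 0 := Submodule.inner_right_of_mem_orthogonal (hu_mem i) hyE
        have hb' : ⟪u i, y - y₁⟫_ℝ = 0 := Submodule.inner_right_of_mem_orthogonal (hu_phys i) hy₂
        have hsplit : ⟪u i, y₁⟫_ℝ = ⟪u i, y⟫_ℝ - ⟪u i, y - y₁⟫_ℝ := by
          rw [← inner_sub_right, sub_sub_cancel]
        rw [hsplit, ha, hb', sub_zero]
      calc AP y = AP (y₁ + (y - y₁)) := by rw [add_sub_cancel]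
        _ = AP y₁ + AP (y - y₁) := map_add _ _ _
        _ = 0 := by rw [h1, h2, h3, add_zero]
  have hlam0 : ∀ i, 0 ≤ lam i := by
    rintro (n | j)
    · simp only [hlamdef, Sum.elim_inl]; exact (levelValue_su2Rep_pos hβ n).le
    · simp only [hlamdef, Sum.elim_inr]; exact le_rfl
  set ef : ℕ → GaugeConfig 3 L SU2 → ℝ := fun k => ((e k : physSubmodule L) : GaugeConfig 3 L SU2 → ℝ) with hef
  have hef_phys : ∀ k, IsPhys (ef k) := fun k => isPhys_coe (e k)
  refine ⟨ℕ ⊕ w, inferInstance, b, lam, AP, Sum.inl, ef, hAP, hsaP, hbAP, hlam0, Sum.inl_injective, ?_, fun k => ?_, fun k => ?_,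
    hef_phys, hon, heig, fun σ U => rawVacuum_comp_configPerm β (hef_phys 0) (heig 0) σ U⟩
  · rintro (n | j) hn
    · exact absurd (Set.mem_range_self n) hn
    · rfl
  · rfl
  · rw [hb]
    show ((toL2 (e k) : Lp ℝ 2 (configMeasure SU2 L)) : GaugeConfig 3 L SU2 → ℝ) =ᵐ[configMeasure SU2 L] ef k
    exact coeFn_toL2 (e k)

/-! ## §2 Bessel against honest bounded test functions -/

section Data

variable {ι : Type} {b : HilbertBasis ι ℝ (Lp ℝ 2 (configMeasure SU2 L))} {lam : ι → ℝ}
  {AP : Lp ℝ 2 (configMeasure SU2 L) →L[ℝ] Lp ℝ 2 (configMeasure SU2 L)} {emb : ℕ → ι}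
  {e : ℕ → (GaugeConfig 3 L SU2 → ℝ)} {β : ℝ}

/-- The coefficient of the class of a bounded measurable `f` along `b (emb k)` is the honest integral `∫ f e_k`. [folklore] -/
theorem eigenData_inner_eq (hbe : ∀ k, ((b (emb k) : Lp ℝ 2 (configMeasure SU2 L)) : GaugeConfig 3 L SU2 → ℝ) =ᵐ[configMeasure SU2 L] e k)
    {f : GaugeConfig 3 L SU2 → ℝ} (hf : Measurable f) {B : ℝ} (hfb : ∀ x, ‖f x‖ ≤ B) (k : ℕ) :
    ⟪b (emb k), (memLp_two_of_bound (μ := configMeasure SU2 L) hf hfb).toLp f⟫_ℝ = ∫ U, f U * e k U ∂configMeasure SU2 L := by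
  rw [inner_eq_integral]
  refine integral_congr_ae ?_
  filter_upwards [hbe k, (memLp_two_of_bound (μ := configMeasure SU2 L) hf hfb).coeFn_toLp] with U h1 h2
  rw [h1, h2, mul_comm]

/-- **Bessel's inequality against the physical eigenbasis**: `Σ_k (∫ f e_k)² ≤ ∫ f²` for bounded measurable `f` (Parseval along `b`, restricted
to the range of `emb`). [cite: ReedSimonI1980, Thm. II.6] -/
theorem eigenData_bessel (hinj : Function.Injective emb)
    (hbe : ∀ k, ((b (emb k) : Lp ℝ 2 (configMeasure SU2 L)) : GaugeConfig 3 L SU2 → ℝ) =ᵐ[configMeasure SU2 L] e k)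
    {f : GaugeConfig 3 L SU2 → ℝ} (hf : Measurable f) {B : ℝ} (hfb : ∀ x, ‖f x‖ ≤ B) :
    Summable (fun k : ℕ => (∫ U, f U * e k U ∂configMeasure SU2 L) ^ 2) ∧
      ∑' k : ℕ, (∫ U, f U * e k U ∂configMeasure SU2 L) ^ 2 ≤ ∫ U, f U ^ 2 ∂configMeasure SU2 L := by
  set v : Lp ℝ 2 (configMeasure SU2 L) := (memLp_two_of_bound (μ := configMeasure SU2 L) hf hfb).toLp f with hv
  have hpars := hasSum_inner_sq_norm_sq b v
  have hs : Summable fun k : ℕ => ⟪b (emb k), v⟫_ℝ ^ 2 := hpars.summable.comp_injective hinj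
  have hle : ∑' k : ℕ, ⟪b (emb k), v⟫_ℝ ^ 2 ≤ ‖v‖ ^ 2 := by
    rw [← hpars.tsum_eq]
    have h := tsum_comp_le_tsum_of_inj hpars.summable (fun _ => sq_nonneg _) hinj
    simpa only [Function.comp_def] using h
  have hnorm : ‖v‖ ^ 2 = ∫ U, f U ^ 2 ∂configMeasure SU2 L := by
    rw [← real_inner_self_eq_norm_sq, inner_eq_integral]
    refine integral_congr_ae ?_
    filter_upwards [(memLp_two_of_bound (μ := configMeasure SU2 L) hf hfb).coeFn_toLp] with U hU
    rw [hU, sq]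
  simp only [hv, eigenData_inner_eq hbe hf hfb] at hs hle
  exact ⟨hs, hnorm ▸ hle⟩

/-! ## §3 The bilinear spectral expansion against honest bounded test functions -/

/-- **Bilinear spectral expansion**: `Σ_k λ_k^n (∫ f e_k) (∫ g e_k) = ∫ f · (κ_P^[n] g)` for bounded measurable `f, g` and `n ≥ 1` (`κ_P` the
pointwise operator of `K_β^P`; the part of the Hilbert basis off the physical eigenbasis has eigenvalue `0`). [cite: ReedSimonI1980, Thm. VI.22–VI.23] -/
theorem eigenData_bilinear
    (hAP : ∀ φ : Lp ℝ 2 (configMeasure SU2 L),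
      (AP φ : GaugeConfig 3 L SU2 → ℝ) =ᵐ[configMeasure SU2 L] fun x => ∫ y, physKernel β x y * φ y ∂configMeasure SU2 L)
    (hsa : IsSelfAdjoint AP) (hbAP : ∀ i, AP (b i) = lam i • b i) (hinj : Function.Injective emb)
    (hoff : ∀ i ∉ Set.range emb, lam i = 0) (hlam : ∀ k, lam (emb k) = levelValue su2Rep L β k)
    (hbe : ∀ k, ((b (emb k) : Lp ℝ 2 (configMeasure SU2 L)) : GaugeConfig 3 L SU2 → ℝ) =ᵐ[configMeasure SU2 L] e k)
    {f g : GaugeConfig 3 L SU2 → ℝ} (hf : Measurable f) {Bf : ℝ} (hfb : ∀ x, ‖f x‖ ≤ Bf) (hg : Measurable g) {Bg : ℝ}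
    (hgb : ∀ x, ‖g x‖ ≤ Bg) {n : ℕ} (hn : 1 ≤ n) :
    HasSum (fun k : ℕ => levelValue su2Rep L β k ^ n * (∫ U, f U * e k U ∂configMeasure SU2 L) *
        (∫ U, g U * e k U ∂configMeasure SU2 L))
      (∫ U, f U * ((fun φ : GaugeConfig 3 L SU2 → ℝ => fun w => ∫ z, physKernel β w z * φ z ∂configMeasure SU2 L)^[n] g) U
        ∂configMeasure SU2 L) := by
  set vf : Lp ℝ 2 (configMeasure SU2 L) := (memLp_two_of_bound (μ := configMeasure SU2 L) hf hfb).toLp f with hvf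
  set vg : Lp ℝ 2 (configMeasure SU2 L) := (memLp_two_of_bound (μ := configMeasure SU2 L) hg hgb).toLp g with hvg
  -- abstract expansion `⟪vf, A_P^n vg⟫ = Σᵢ λᵢ^n ⟪vf, bᵢ⟫ ⟪bᵢ, vg⟫`
  have hpow : ∀ (j : ℕ) (i : ι), (AP ^ j) (b i) = lam i ^ j • b i := by
    intro j i
    induction j with
    | zero => simp
    | succ j ih => rw [pow_succ', mul_apply_eq_comp, ih, map_smul, hbAP, smul_smul, pow_succ, mul_comm]
  have h := b.hasSum_inner_mul_inner vf ((AP ^ n) vg)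
  have h1 : ∀ i, ⟪vf, b i⟫_ℝ * ⟪b i, (AP ^ n) vg⟫_ℝ = lam i ^ n * ⟪b i, vf⟫_ℝ * ⟪b i, vg⟫_ℝ := fun i => by
    rw [← (hsa.pow n).adjoint_eq, ContinuousLinearMap.adjoint_inner_right, hpow n i, real_inner_smul_left, real_inner_comm (b i) vf]
    ring
  simp only [h1] at h
  -- the value: `⟪vf, A_P^n vg⟫ = ∫ f · κ_P^[n] g`
  have hval : ⟪vf, (AP ^ n) vg⟫_ℝ = ∫ U, f U * ((fun φ : GaugeConfig 3 L SU2 → ℝ => fun w => ∫ z, physKernel β w z * φ z ∂configMeasure SU2 L)^[n] g) U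
      ∂configMeasure SU2 L := by
    rw [inner_eq_integral]
    refine integral_congr_ae ?_
    filter_upwards [(memLp_two_of_bound (μ := configMeasure SU2 L) hf hfb).coeFn_toLp,
      pow_kernelOp_toLp_ae_eq_iterate (μ := configMeasure SU2 L) hAP hg hgb n] with U h2 h3
    rw [h2, h3]
  rw [hval] at h
  -- restrict to the range of `emb`
  have h0 : ∀ i ∉ Set.range emb, lam i ^ n * ⟪b i, vf⟫_ℝ * ⟪b i, vg⟫_ℝ = 0 := fun i hi => by
    rw [hoff i hi, zero_pow (by omega), zero_mul, zero_mul]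
  have h2 := (Function.Injective.hasSum_iff hinj h0).mpr h
  refine h2.congr_fun fun k => ?_
  simp only [Function.comp_apply, hlam k, hvf, hvg, eigenData_inner_eq hbe hf hfb, eigenData_inner_eq hbe hg hgb]

end Data

end Summit.QuantumFields.YangMills.Theorems.FemtoTransferGap.TT

end
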